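import Summits.QuantumFields.BalabanUV.Beta.RowD1SymmetriesDischarged
import Summits.QuantumFields.BalabanUV.Beta.FP.RoadRowD1Slots
import Summits.QuantumFields.BalabanUV.Gaps.D1WardLongitudinalForm

/-!
# `BalabanUV.Gaps.D1CoDressedLongitudinalForm` — cell pub-balaban-gaps, row (D1), seat g1-p1: FOR THE β SUB-CELL's CHART-(II) CO-DRESSED LITERAL `JsRowD1Pin hLc N` — THE ONE LITERAL
# OF ROW (D1) WHOSE SYMMETRY HALF IS CLOSED — THE LEMMA 5.2 VALUE FORMS OF THE (1.22) COEFFICIENT ARE HYPOTHESIS-FREE AT EVERY LEVEL, AND ITS SIGN NEEDS THE PSD OF THE CONVOLUTION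
# FORM ONLY; (D1) for that literal IS a one-loop drift law of the diagonal longitudinal moments

HONEST FRAMING (cell rule, page 1 of everything): [folklore] composition BY NAME — the β sub-cell's `RowD1SymmetriesDischarged.symmetries_JsRowD1Pin` (an2 gen 21, 2026-08-20: `hW` (5.9)
AND `hR` (5.7) for `JsRowD1Pin hLc N` from `Odd Lc`, `2 ≤ N` only — the owner's gauge-letters chain + an3's `RootedBorderTableLaw.bondLaw`), road FP's `FP.RoadRowD1Slots.TbalOf_JsRowD1_swap`
((5.8) for `JsRowD1 hLc N cΛ cB`, no hypothesis), GEN 14's `D1IndexSymmetryDictionary.momentSummable_flipK_TbalOf` (moment summability of every one-step kernel), the β sub-cell's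
`PolarizationSign.secondMoment_eq_neg_half ∕ secondMoment_eq_neg_quarter ∕ secondMoment_nonneg_of_reflection ∕ first_moment_eq_zero ∕ tsum_eq_zero_of_ward` and an1's
`OddMoments.firstMoment_eq_zero_of_reflectionCovariant`, leaf-01's `D1BFx.WardDiagonalSecondMoment.secondMoment_self_eq_zero_of_ward ∕ tsum_mul_sq_add_eq_two_mul_secondMoment`, an4's
`OneStepKernelFamily.secondMoment_flipK`, row 86's `D1WardLongitudinalForm.tsum_diag_sq_flipK`.  `JsRowD1Pin` is the β sub-cell's chart-(II) literal (`JsRowD1 hLc N (2∕Lc⁴) (−Lc¹²∕4)`, centred root, co-dressed); it is NOT the cell's (III′) literal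
of record `JsB12CombShSym …` and NOT a member of the β-lead's axially dressed pinned family `JsBalAn1` (different dressing — `D1PinnedIndexSymmetry` docstring); which object is print's `Π`
((P6)) is NOT decided.  The PSD hypothesis `ConvPSD (flipK (TbalOf … j))` (Lemma 5.2 (ii)) is NOT proved for any literal.  NOTHING of Bałaban's asserted beyond print ((5.7)–(5.9) are PRINTED for
Bałaban's `Π` [Balaban1987RG1 p. 293]); NO coefficient computed or signed; (D1) NOT discharged for any literal (for `JsRowD1Pin`: `D1Tel`, `D1Rep` open — 2∕4 binders, the owner's count);
NOT `BetaPertH`, NOT continuum, NOT Clay.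
HONEST DEPENDENCY (b2b cell, verbatim): «continuum YM on T⁴ ⇐ BetaPertH ∧ nine spine estimates (0/9 proved); BetaPertH ⇐ (D1) ∧ (D4) ∧ CAP+tail; G-an2-4 gates asym, D1 and NE2/3/4.»

WHY (census row 87 of `HOME/g1/RESIDUE.md`; companion of row 86 ∕ `Gaps/D1WardLongitudinalForm`).  Row 86 removed `hR` from the β sub-cell's Lemma 5.2 at the two literals where `hW` is
still a hypothesis.  At the ONE literal of row (D1) where BOTH symmetry binders are theorems — an2's `JsRowD1Pin` — nothing is left to assume for the VALUE forms: at EVERY level `j` and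
every pair `μ ≠ ν`, HYPOTHESIS-FREE (given `Odd Lc`, `2 ≤ N`),
`β⁰_j(μ,ν) = secondMoment (T_j) μ ν = −½ Σ_z T_j(ν,ν,z) z_μ² = −½ Σ_z T_j(μ,μ,z) z_ν² = −¼ (both)`, `β⁰_j(β,β) = 0`, every zeroth and first moment of `flipK T_j` vanishes, and
`Σ_z flipK T_j(μ,ν,z) (z_μ + z_ν)² = 2 β⁰_j(μ,ν)`; the SIGN `0 ≤ β⁰_j(μ,ν)` follows from `ConvPSD (flipK T_j)` ALONE (`secondMoment_TbalOf_JsRowD1Pin_nonneg_of_convPSD`).  Consequently the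
row's target for that literal, `D1Drift Lc (JsRowD1Pin hLc N) Nc μ ν` (a `OneLoopDrift` law of `j ↦ β⁰_j(μ,ν)` with slope `stepBal Nc Lc`), IS the same drift law for the sequence of
diagonal longitudinal moments `j ↦ −½ Σ_z T_j(ν,ν,z) z_μ²` (`d1Drift_JsRowD1Pin_iff_longitudinal`) — no symmetry hypothesis anywhere.
WHAT IT IS NOT: `D1Tel`, `D1Rep` (the owner's remaining binders for this literal) and `ConvPSD` remain HYPOTHESES; nothing is discharged; the words of the row do not move.

CONTENT (all [folklore]; no `def`, no `def … : Prop`, 0 sorry): §1 `indexSymmetric_flipK_TbalOf_JsRowD1` ((5.8) as `PolarizationSign.IndexSymmetric` for road FP's block-mean literal, any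
`cΛ, cB`), `indexSymmetric_flipK_TbalOf_JsRowD1Pin`; §2 HYPOTHESIS-FREE at `JsRowD1Pin hLc N` (`Odd Lc`, `2 ≤ N`), every level: `zerothMoment_flipK_TbalOf_JsRowD1Pin_eq_zero`,
`firstMoment_flipK_TbalOf_JsRowD1Pin_eq_zero`, `secondMoment_TbalOf_JsRowD1Pin_self_eq_zero`, **`secondMoment_TbalOf_JsRowD1Pin_eq_neg_half`**, `…_eq_neg_half_left`, **`…_eq_neg_quarter`**,
`longitudinalMoment_TbalOf_JsRowD1Pin_diag_comm`, `diagMomentum_eq_two_mul_secondMoment_JsRowD1Pin`; §3 **`secondMoment_TbalOf_JsRowD1Pin_nonneg_of_convPSD`** (Lemma 5.2 for this literal from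
PSD alone); §4 **`d1Drift_JsRowD1Pin_iff_longitudinal`** ((D1) for this literal ⟺ the drift law of the diagonal longitudinal moments).

Provenance: cell pub-balaban-gaps, seat g1-p1 GEN 17 (prover-pub-balaban-gaps-g1-p1-g17-0), 2026-08-25; imports `Beta/RowD1SymmetriesDischarged` (2026-08-20), `Beta/FP/RoadRowD1Slots`,
this seat's `Gaps/D1WardLongitudinalForm` (p401914 ✓; through it GEN 14's `D1IndexSymmetryDictionary`); no existing file touched; INTENT I-gapsg1p1-64 names the β sub-cell's row-D1 OWNER an2 (first refusal).
-/

noncomputable section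

open Literature.MathematicalPhysics.QuantumFieldTheory Balaban1983to89 Balaban1983to89.Beta
open OneStepResolventKernel (JetData)
open OneStepKernelFamily (TbalOf flipK D1Drift secondMoment_flipK)
open PolarizationSign (IndexSymmetric WardTransversal AxisReflectionCovariant MomentSummable ConvPSD secondMoment_comm secondMoment_eq_neg_half secondMoment_eq_neg_quarter
  secondMoment_nonneg_of_reflection first_moment_eq_zero tsum_eq_zero_of_ward)
open OddMoments (firstMoment zerothMoment firstMoment_eq_zero_of_reflectionCovariant)
open Drift (OneLoopDrift)
open Summit.QuantumFields.BalabanUV.Beta.RowD1JointEnd (JsRowD1 JsRowD1Pin JsRowD1Pin_eq)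
open Summit.QuantumFields.BalabanUV.Beta.RowD1SymmetriesDischarged (symmetries_JsRowD1Pin)
open Summit.QuantumFields.BalabanUV.Beta.FP.RoadRowD1Slots (TbalOf_JsRowD1_swap)
open Summit.QuantumFields.BalabanUV.Beta.D1BFx.WardDiagonalSecondMoment (secondMoment_self_eq_zero_of_ward tsum_mul_sq_add_eq_two_mul_secondMoment)
open Summit.QuantumFields.BalabanUV.Gaps.D1IndexSymmetryDictionary (momentSummable_flipK_TbalOf)
open Summit.QuantumFields.BalabanUV.Gaps.D1WardLongitudinalForm (tsum_diag_sq_flipK)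

namespace Summit.QuantumFields.BalabanUV.Gaps.D1CoDressedLongitudinalForm

variable {Lc : ℕ} [NeZero Lc]

/-! ## §1 (5.8) for road FP's block-mean literal as `IndexSymmetric` -/

/-- [folklore] (5.8) for the co-dressed block-mean literal `JsRowD1 hLc N cΛ cB` (any `cΛ, cB`, every level), in the printed variable: `IndexSymmetric (flipK (TbalOf Lc (JsRowD1 …) j))` —
road FP's hypothesis-free `TbalOf_JsRowD1_swap`, repackaged. -/
theorem indexSymmetric_flipK_TbalOf_JsRowD1 (hLc : Odd Lc) (N : ℕ) (cΛ cB : ℝ) (j : ℕ) : IndexSymmetric (flipK (TbalOf Lc (JsRowD1 hLc N cΛ cB) j)) := by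
  intro μ ν x
  simp only [OneStepKernelFamily.flipK_apply, neg_neg]
  have h := TbalOf_JsRowD1_swap hLc N cΛ cB j μ ν (-x)
  rw [neg_neg] at h
  exact h

/-- [folklore] … at the pinned constants: `IndexSymmetric (flipK (TbalOf Lc (JsRowD1Pin hLc N) j))`. -/
theorem indexSymmetric_flipK_TbalOf_JsRowD1Pin (hLc : Odd Lc) (N : ℕ) (j : ℕ) : IndexSymmetric (flipK (TbalOf Lc (JsRowD1Pin hLc N) j)) := by
  rw [JsRowD1Pin_eq]
  exact indexSymmetric_flipK_TbalOf_JsRowD1 hLc N (2 / (Lc : ℝ) ^ 4) (-((Lc : ℝ) ^ 12 / 4)) j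

/-! ## §2 Hypothesis-free moment laws of `JsRowD1Pin hLc N` (`Odd Lc`, `2 ≤ N`), every level -/

/-- [folklore] EVERY ZEROTH MOMENT of the flipped level-`j` kernel of `JsRowD1Pin` VANISHES — `tsum_eq_zero_of_ward` with `hW` the owner's theorem. -/
theorem zerothMoment_flipK_TbalOf_JsRowD1Pin_eq_zero (hLc : Odd Lc) {N : ℕ} (hN : 2 ≤ N) (j : ℕ) (α ν : Fin 4) :
    ∑' z, flipK (TbalOf Lc (JsRowD1Pin hLc N) j) α ν z = 0 :=
  tsum_eq_zero_of_ward (momentSummable_flipK_TbalOf _ j 3) ((symmetries_JsRowD1Pin hLc hN).1 j) α ν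

/-- [folklore] EVERY FIRST MOMENT of the flipped level-`j` kernel of `JsRowD1Pin` VANISHES — an1's `firstMoment_eq_zero_of_reflectionCovariant` with `hR` the owner's theorem (so GEN 15's
four parity-odd numbers are zero for this literal, as its docstring anticipates). -/
theorem firstMoment_flipK_TbalOf_JsRowD1Pin_eq_zero (hLc : Odd Lc) {N : ℕ} (hN : 2 ≤ N) (j : ℕ) (μ ν γ : Fin 4) :
    firstMoment (flipK (TbalOf Lc (JsRowD1Pin hLc N) j)) μ ν γ = 0 :=
  firstMoment_eq_zero_of_reflectionCovariant ((symmetries_JsRowD1Pin hLc hN).2 j) μ ν γ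

/-- [folklore] THE DIAGONAL (1.22) ENTRIES OF `JsRowD1Pin` VANISH AT EVERY LEVEL: `secondMoment (T_j) β β = 0` — leaf-01's `secondMoment_self_eq_zero_of_ward`, `hW` the owner's theorem, flip
removed by an4's `secondMoment_flipK`. -/
theorem secondMoment_TbalOf_JsRowD1Pin_self_eq_zero (hLc : Odd Lc) {N : ℕ} (hN : 2 ≤ N) (j : ℕ) (β : Fin 4) :
    B12Beta.secondMoment (TbalOf Lc (JsRowD1Pin hLc N) j) β β = 0 := by
  rw [← secondMoment_flipK]
  exact secondMoment_self_eq_zero_of_ward (momentSummable_flipK_TbalOf _ j 3) ((symmetries_JsRowD1Pin hLc hN).1 j) β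

/-- [folklore] **THE (1.22) COEFFICIENT OF `JsRowD1Pin` ON THE RIGHT DIAGONAL CHANNEL, HYPOTHESIS-FREE**: at every level `j`, for `μ ≠ ν`,
`β⁰_j(μ,ν) = secondMoment (T_j) μ ν = −½ Σ_z T_j(ν,ν,z) z_μ²`, `T_j := TbalOf Lc (JsRowD1Pin hLc N) j` — the β sub-cell's `secondMoment_eq_neg_half` with ALL its inputs theorems: summable
moments (GEN 14), `hW` (an2 gen 21), the first moment `Σ_z P_{μν}(z) z_ν = 0` (`first_moment_eq_zero` on an2∕an3's `hR`). -/
theorem secondMoment_TbalOf_JsRowD1Pin_eq_neg_half (hLc : Odd Lc) {N : ℕ} (hN : 2 ≤ N) (j : ℕ) {μ ν : Fin 4} (hμν : μ ≠ ν) :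
    B12Beta.secondMoment (TbalOf Lc (JsRowD1Pin hLc N) j) μ ν = -(1 / 2) * ∑' z, TbalOf Lc (JsRowD1Pin hLc N) j ν ν z * (z μ : ℝ) ^ 2 := by
  rw [← secondMoment_flipK, ← tsum_diag_sq_flipK]
  exact secondMoment_eq_neg_half (momentSummable_flipK_TbalOf _ j 3) ((symmetries_JsRowD1Pin hLc hN).1 j) hμν
    (first_moment_eq_zero ((symmetries_JsRowD1Pin hLc hN).2 j) hμν)

/-- [folklore] … ON THE LEFT DIAGONAL CHANNEL: `β⁰_j(μ,ν) = −½ Σ_z T_j(μ,μ,z) z_ν²` (`μ ≠ ν`), by (5.8)'s `secondMoment_comm`. -/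
theorem secondMoment_TbalOf_JsRowD1Pin_eq_neg_half_left (hLc : Odd Lc) {N : ℕ} (hN : 2 ≤ N) (j : ℕ) {μ ν : Fin 4} (hμν : μ ≠ ν) :
    B12Beta.secondMoment (TbalOf Lc (JsRowD1Pin hLc N) j) μ ν = -(1 / 2) * ∑' z, TbalOf Lc (JsRowD1Pin hLc N) j μ μ z * (z ν : ℝ) ^ 2 := by
  rw [← secondMoment_flipK, secondMoment_comm (indexSymmetric_flipK_TbalOf_JsRowD1Pin hLc N j) μ ν, secondMoment_flipK]
  exact secondMoment_TbalOf_JsRowD1Pin_eq_neg_half hLc hN j hμν.symm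

/-- [folklore] **THE SYMMETRIC FORM, HYPOTHESIS-FREE**: `β⁰_j(μ,ν) = −¼ (Σ_z T_j(ν,ν,z) z_μ² + Σ_z T_j(μ,μ,z) z_ν²)` for `JsRowD1Pin` (`μ ≠ ν`, every level) — the β sub-cell's
`secondMoment_eq_neg_quarter` with summability, `hW`, (5.8), `hR` ALL theorems. -/
theorem secondMoment_TbalOf_JsRowD1Pin_eq_neg_quarter (hLc : Odd Lc) {N : ℕ} (hN : 2 ≤ N) (j : ℕ) {μ ν : Fin 4} (hμν : μ ≠ ν) :
    B12Beta.secondMoment (TbalOf Lc (JsRowD1Pin hLc N) j) μ ν =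
      -(1 / 4) * (∑' z, TbalOf Lc (JsRowD1Pin hLc N) j ν ν z * (z μ : ℝ) ^ 2 + ∑' z, TbalOf Lc (JsRowD1Pin hLc N) j μ μ z * (z ν : ℝ) ^ 2) := by
  rw [← secondMoment_flipK, ← tsum_diag_sq_flipK, ← tsum_diag_sq_flipK (TbalOf Lc (JsRowD1Pin hLc N) j) μ ν]
  exact secondMoment_eq_neg_quarter (momentSummable_flipK_TbalOf _ j 3) ((symmetries_JsRowD1Pin hLc hN).1 j) (indexSymmetric_flipK_TbalOf_JsRowD1Pin hLc N j)
    ((symmetries_JsRowD1Pin hLc hN).2 j) hμν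

/-- [folklore] THE TWO DIAGONAL READINGS OF `JsRowD1Pin` AGREE: `Σ_z T_j(ν,ν,z) z_μ² = Σ_z T_j(μ,μ,z) z_ν²` (`μ ≠ ν`, every level), hypothesis-free. -/
theorem longitudinalMoment_TbalOf_JsRowD1Pin_diag_comm (hLc : Odd Lc) {N : ℕ} (hN : 2 ≤ N) (j : ℕ) {μ ν : Fin 4} (hμν : μ ≠ ν) :
    ∑' z, TbalOf Lc (JsRowD1Pin hLc N) j ν ν z * (z μ : ℝ) ^ 2 = ∑' z, TbalOf Lc (JsRowD1Pin hLc N) j μ μ z * (z ν : ℝ) ^ 2 := by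
  have h1 := secondMoment_TbalOf_JsRowD1Pin_eq_neg_half hLc hN j hμν
  have h2 := secondMoment_TbalOf_JsRowD1Pin_eq_neg_half_left hLc hN j hμν
  linarith

/-- [folklore] THE CAP LANE's DIAGONAL-MOMENTUM FORM OF (1.22) FOR `JsRowD1Pin`, HYPOTHESIS-FREE: `Σ_z flipK T_j(μ,ν,z)·(z_μ + z_ν)² = 2·β⁰_j(μ,ν)` (any `μ, ν`, every level) — leaf-01's
`tsum_mul_sq_add_eq_two_mul_secondMoment` with `hW` and (5.8) theorems (GEN 14's `D1IndexSymmetryDictionary` recorded the same under `hW` as a hypothesis for the other two literals). -/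
theorem diagMomentum_eq_two_mul_secondMoment_JsRowD1Pin (hLc : Odd Lc) {N : ℕ} (hN : 2 ≤ N) (j : ℕ) (μ ν : Fin 4) :
    ∑' z, flipK (TbalOf Lc (JsRowD1Pin hLc N) j) μ ν z * ((z μ : ℝ) + (z ν : ℝ)) ^ 2 = 2 * B12Beta.secondMoment (TbalOf Lc (JsRowD1Pin hLc N) j) μ ν := by
  rw [← secondMoment_flipK]
  exact tsum_mul_sq_add_eq_two_mul_secondMoment (momentSummable_flipK_TbalOf _ j 3) ((symmetries_JsRowD1Pin hLc hN).1 j) (indexSymmetric_flipK_TbalOf_JsRowD1Pin hLc N j) μ ν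

/-! ## §3 Lemma 5.2 for `JsRowD1Pin` from the PSD of the convolution form ALONE -/

/-- [folklore] **THE β SUB-CELL's LEMMA 5.2 FOR ITS CHART-(II) LITERAL NEEDS ONLY THE PSD**: if the convolution form of the flipped level-`j` kernel of `JsRowD1Pin hLc N` is positive
semi-definite (`ConvPSD`, Lemma 5.2 (ii) — NOT proved), then `0 ≤ β⁰_j(μ,ν)` (`μ ≠ ν`) — `secondMoment_nonneg_of_reflection` with summability, `hW`, `hR` theorems. -/
theorem secondMoment_TbalOf_JsRowD1Pin_nonneg_of_convPSD (hLc : Odd Lc) {N : ℕ} (hN : 2 ≤ N) (j : ℕ) (hPSD : ConvPSD (flipK (TbalOf Lc (JsRowD1Pin hLc N) j)))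
    {μ ν : Fin 4} (hμν : μ ≠ ν) : 0 ≤ B12Beta.secondMoment (TbalOf Lc (JsRowD1Pin hLc N) j) μ ν := by
  rw [← secondMoment_flipK]
  exact secondMoment_nonneg_of_reflection (momentSummable_flipK_TbalOf _ j 3) ((symmetries_JsRowD1Pin hLc hN).1 j) hPSD ((symmetries_JsRowD1Pin hLc hN).2 j) hμν

/-- [folklore] … hence under `∀ j, PSD_j` the (1.22) sequence of `JsRowD1Pin` is termwise `≥ 0` and its cumulative sums are MONOTONE (bookkeeping for the drift law below). -/
theorem cumulative_secondMoment_TbalOf_JsRowD1Pin_mono_of_convPSD (hLc : Odd Lc) {N : ℕ} (hN : 2 ≤ N) (hPSD : ∀ j : ℕ, ConvPSD (flipK (TbalOf Lc (JsRowD1Pin hLc N) j)))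
    {μ ν : Fin 4} (hμν : μ ≠ ν) : Monotone fun k : ℕ => ∑ j ∈ Finset.range k, B12Beta.secondMoment (TbalOf Lc (JsRowD1Pin hLc N) j) μ ν :=
  monotone_nat_of_le_succ fun k => by
    rw [Finset.sum_range_succ]
    exact le_add_of_nonneg_right (secondMoment_TbalOf_JsRowD1Pin_nonneg_of_convPSD hLc hN k (hPSD k) hμν)

/-! ## §4 (D1) for `JsRowD1Pin` IS the drift law of the diagonal longitudinal moments -/

/-- [folklore] **(D1) FOR THE CHART-(II) LITERAL IS A ONE-LOOP DRIFT LAW OF ONE DIAGONAL CHANNEL, HYPOTHESIS-FREE**: for `μ ≠ ν` and every `Nc`,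
`D1Drift Lc (JsRowD1Pin hLc N) Nc μ ν` ⟺ `∃ A, OneLoopDrift (stepBal Nc Lc) A (j ↦ −½ Σ_z T_j(ν,ν,z) z_μ²)` — the sequence in the binder's definition IS that sequence, term by term
(`secondMoment_TbalOf_JsRowD1Pin_eq_neg_half`). -/
theorem d1Drift_JsRowD1Pin_iff_longitudinal (hLc : Odd Lc) {N : ℕ} (hN : 2 ≤ N) {μ ν : Fin 4} (hμν : μ ≠ ν) (Nc : ℝ) :
    D1Drift Lc (JsRowD1Pin hLc N) Nc μ ν ↔
      ∃ A : ℝ, OneLoopDrift (B12Normalization.stepBal Nc Lc) A (fun j => -(1 / 2) * ∑' z, TbalOf Lc (JsRowD1Pin hLc N) j ν ν z * (z μ : ℝ) ^ 2) := by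
  have h : (fun j => B12Beta.secondMoment (TbalOf Lc (JsRowD1Pin hLc N) j) μ ν) = fun j => -(1 / 2) * ∑' z, TbalOf Lc (JsRowD1Pin hLc N) j ν ν z * (z μ : ℝ) ^ 2 :=
    funext fun j => secondMoment_TbalOf_JsRowD1Pin_eq_neg_half hLc hN j hμν
  unfold D1Drift
  rw [h]

/-- [folklore] … and (D1) in one channel is (D1) in the transposed channel (the binder's sequence is channel-symmetric by (5.8); hypothesis-free). -/
theorem d1Drift_JsRowD1Pin_comm (hLc : Odd Lc) (N : ℕ) (μ ν : Fin 4) (Nc : ℝ) :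
    D1Drift Lc (JsRowD1Pin hLc N) Nc μ ν ↔ D1Drift Lc (JsRowD1Pin hLc N) Nc ν μ := by
  have h : (fun j => B12Beta.secondMoment (TbalOf Lc (JsRowD1Pin hLc N) j) μ ν) = fun j => B12Beta.secondMoment (TbalOf Lc (JsRowD1Pin hLc N) j) ν μ :=
    funext fun j => by rw [← secondMoment_flipK, secondMoment_comm (indexSymmetric_flipK_TbalOf_JsRowD1Pin hLc N j) μ ν, secondMoment_flipK]
  unfold D1Drift
  rw [h]

/-- [folklore] … while in a DIAGONAL channel the binder degenerates: `D1Drift Lc (JsRowD1Pin hLc N) Nc β β` ⟺ `stepBal Nc Lc = 0` (the sequence is identically zero by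
`secondMoment_TbalOf_JsRowD1Pin_self_eq_zero`; print's (1.22) excludes `μ = ν`). -/
theorem d1Drift_JsRowD1Pin_self_iff (hLc : Odd Lc) {N : ℕ} (hN : 2 ≤ N) (β : Fin 4) (Nc : ℝ) :
    D1Drift Lc (JsRowD1Pin hLc N) Nc β β ↔ B12Normalization.stepBal Nc Lc = 0 := by
  have h : (fun j => B12Beta.secondMoment (TbalOf Lc (JsRowD1Pin hLc N) j) β β) = fun _ => 0 :=
    funext fun j => secondMoment_TbalOf_JsRowD1Pin_self_eq_zero hLc hN j β
  unfold D1Drift OneLoopDrift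
  rw [h]
  constructor
  · rintro ⟨A, hA⟩
    by_contra hs
    -- |0 − k·s| ≤ A for all k forces s = 0
    obtain ⟨k, hk⟩ := exists_nat_gt (A / |B12Normalization.stepBal Nc Lc|)
    have hs' : 0 < |B12Normalization.stepBal Nc Lc| := abs_pos.mpr hs
    have h1 := hA k
    simp only [Finset.sum_const_zero, zero_sub, abs_neg, abs_mul, Nat.abs_cast] at h1
    have h2 : A < (k : ℝ) * |B12Normalization.stepBal Nc Lc| := by
      rw [div_lt_iff₀ hs'] at hk; linarith
    linarith
  · intro hs
    refine ⟨0, fun k => ?_⟩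
    simp [hs]

end Summit.QuantumFields.BalabanUV.Gaps.D1CoDressedLongitudinalForm

end
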